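import Literature.NumberTheory.Automorphic.BrandtGrossPoints
import Literature.NumberTheory.Automorphic.BrandtXi
import Literature.NumberTheory.EllipticCurves.HeegnerPoints
import Literature.NumberTheory.EllipticCurves.GlobalMinimalModel
import Literature.NumberTheory.EllipticCurves.Selmer
import Literature.NumberTheory.EllipticCurves.Sha
import Literature.NumberTheory.EllipticCurves.MordellWeil
import Literature.NumberTheory.EllipticCurves.BSDQuotientOverNumberField
import Literature.NumberTheory.EllipticCurves.ModularCurve
import Literature.NumberTheory.EllipticCurves.Tamagawa
import Literature.NumberTheory.DiophantineGeometry.TateAlgorithm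

/-!
# AN-47 — THE SIGNED (±) EDGE: `L⁺_edge, L⁻_edge ∈ ℤ₂⟦T⟧` AT THE RAMIFIED PRIME 2 AND THE RANK-ONE LEADING TERM
(planner sketch, seat bsd-f1-sign2-an g32, MEMO-an §35; census `Cruxes/RankOneAtTwoBigImageOddLocal/census36.md`)

Self-contained companion of `DefiniteMod2WaldspurgerAN43.lean` (V18, 200 kB cap, not importable on the farm) and
`EdgeMassFormulaAN45.lean`: the four V12 edge definitions `IsEdgeCMIdeal`, `edgeValue`, `picStep`, `edgeThetaCoeff` and the AN-45
polynomial model `edgeThetaPoly`, `edgeCharFactor` are COPIED VERBATIM (same names, this namespace).  Attached to crux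
`RankOneAtTwoBigImageOddLocal` (stmt-BirchSwinnertonDyer-23715: rank 1, big 2-adic image, odd torsion and Tamagawa ⟹ `BSDp W 2`).

SETTING (MEMO-an §31–§34): `W/ℚ` of PRIME conductor `N ≡ 3 (mod 4)`, `k = ℚ(i)` (the prime `2` RAMIFIES, `𝔭 = (1+i)`), `B` the
definite quaternion algebra of discriminant `N`, `φ` the Hecke eigenvector of `W` on `Pic` of a maximal order, `Φ = w·φ`, `(ψ, I)` the
Gross point of conductor `1`, and the EDGE THETA ELEMENTS `θ_L = Σ_{j<h} Φ(gʲ J_L)[gʲ] ∈ ℤ[G_L]`, `G_L = Pic ℤ[2^L i] ≅ ℤ/h`,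
`h = 2^{L-1}`, `g` = class of the norm-`5` prime (`picStep`), `J_L` a level-`L` edge CM ideal; as a polynomial `P_L(X) = Σ c_j X^j`,
`ℤ[G_L] = ℤ[X]/(X^h - 1)`, `X^h - 1 = ∏_{m ≤ L} F_m`, `F_1 = X - 1`, `F_m = X^{2^{m-2}} + 1 = Φ_{2^{m-1}}(X)` (`edgeCharFactor`).
Throughout §35 the curve is SUPERSINGULAR at `2` with `a₂ = 0` (36 of the 127 archive curves; then `N ≡ 3 (mod 8)`, `Δ = -N`).

§35 RESULTS (engine `MEMO-an-data/g32/ana/pm35.py`, `an3–an11.py` on the g28 T58 integer theta archive: 127 curves of prime conductor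
`N ≡ 3 (4)`, `N ≤ 36187`, levels `L ≤ 8…11`; exact integer arithmetic, no kit):
* (Θ-3term) `EdgeThreeTermRelation` — THE GROUP-RING THREE-TERM RELATION `π_{L+1→L}(θ_{L+1}) = a₂·θ_L − ν_{L-1→L}(θ_{L-1})`
  (`π` = projection `ℤ[G_{L+1}] → ℤ[G_L]`, `ν` = corestriction `[σ] ↦ Σ_{σ'↦σ}[σ']`, i.e. multiplication by `F_L` on polynomials),
  ALL reduction types: 892/892 level triples + 127/127 bottom rows, verbatim (no rotation needed: the T58 base points are nested).
  It refines the augmentation recursion (Θ-aug) of AN-45 and is the `T₂`-adjacency on the Bruhat–Tits tree at the ramified prime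
  (a conductor-`2^L` vertex has one neighbour of conductor `2^{L-1}` and two of conductor `2^{L+1}`).  Consequences verified
  separately: the OLD-CHARACTER LAW `d_m(π_{L→m}θ_L) = c_{L-m}(a₂)·d_m(θ_m)` (`c_0 = 1, c_1 = a₂, c_{j+1} = a₂c_j − 2c_{j-1}`;
  2720/2720 + 892 genus rows) and `t_L = dd_L·Φ(I)` (1146/1146).
* (Θ±-div) `SignedEdgeDivisibility` — for `a₂ = 0` the values of `θ_L` at the characters of the levels `m < L`, `m ≢ L (mod 2)` are
  TRIVIAL ZEROS (`c_{L-m} = 0` for `L - m` odd), and `θ_L` is divisible in `ℤ[G_L]` by the half-product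
  `ω̃_L := ∏_{2 ≤ m < L, m ≢ L (2)} F_m` (`signedTrivialFactor`; Pollack's `ω^∓` with `Φ_{2^j}` in place of `Φ_{p^j}`): `θ_L = ω̃_L·Q_L`,
  `deg Q_L < h`, EXACT polynomial division on 254/254 level rows `L ≥ 3` (36 curves) — §31 (F3) had this numerically as
  «`θ_n = ω_n^∓ L_n^±` without denominators»; typed here.
* (Θ±-compat) `SignedEdgeCompatibility` — THE SIGNED QUOTIENTS ARE COMPATIBLE TWO LEVELS APART UP TO SIGN:
  `π_{L+2→L}(Q_{L+2}) + Q_L ≡ 0 (mod M_L)`, `M_L := (X - 1)·∏_{2 ≤ m ≤ L, m ≡ L (2)} F_m` (`signedModulus`; `ω̃_L·M_L = X^h - 1`, and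
  `Q_L` is well defined exactly modulo `M_L`): 218/218 level pairs (114 even-`L`, 104 odd-`L`; 50 of them `0 ≡ 0`).  PROOF SKETCH
  from (Θ-3term) with `a₂ = 0`: `π_{L+2→L}θ_{L+2} = -π(F_{L+1}θ_L) = -2θ_L` in `ℤ[G_L]` (`π(F_{L+1}) = 2`), and `π(ω̃_{L+2}) ≡ 2ω̃_L (mod X^h-1)`,
  then cancel `ω̃_L` (coprime to `M_L`) [R343a fix, -an g33: `2F_L → 2` twice; REF1-AUDIT §343].  (R343b: the port needs (Θ-3term) only
  along the given chain; `EdgeThreeTermRelation` is stated for infinite nested chains, and a finite nested chain of edge CM ideals extends to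
  an infinite one — each `J_m` has edge CM sub-ideals of index `4` — so the infinite-chain form suffices; cf. AN-48 `sharpFlatPair_of_threeTerm`.)  CONSEQUENCE (the lens answer «what is the signed object at 2»): since `M_L ∣ M_{L+2}` and
  `⋂_L (M_L) = 0` in `ℤ₂⟦T⟧` (`T = X - 1`), the limits `L^ε_edge(W) := lim_{L ≡ ε (2)} (-1)^{⌊L/2⌋} Q_L ∈ lim ℤ[X]/(M_L) = ℤ₂⟦T⟧`
  (`ε ∈ {+ = even, - = odd}`) EXIST: a pair of bounded SIGNED 2-ADIC ANTICYCLOTOMIC L-FUNCTIONS OF `W` OVER `ℚ(i)` AT THE RAMIFIED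
  SUPERSINGULAR PRIME `2`, interpolating `χ(θ_m) / ∏_{2≤k<m, k≢m(2)} χ(F_k)` at the characters `χ` of conductor `2^m`, `m ≡ ε (2)`,
  with `L⁻_edge(0) = ±Φ(I)/2`, `L⁺_edge(0) = ±Φ(I)` (`Φ = w·φ`, `Φ(I)² ≐ L(W,1)L(W^{(-1)},1)`, Gross).  Their Iwasawa invariants: `μ(L^±) = 0` on
  36/36 curves (254/254 non-zero level rows), `λ(L⁺)` odd and `λ(L⁻)` even (= (F3) of §31 + `EdgeThetaLambdaParity` of V12),
  `λ` constant along each branch from the first non-zero level on (72/72 branches) — all three are COROLLARIES of (Θ±-compat) + V12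
  and are not re-typed.  TABLE (`(r, r₋₁, r₂, r₋₂)` = analytic ranks of `W, W^{(-1)}, W^{(2)}, W^{(-2)}`; `λ⁺, λ⁻`):
  `(0,0,1,1)` ×13: `(1, 0)`, `L⁺ = (T+2)·unit`, `L⁻` a unit; `(1,1,0,0)` ×12: `λ⁺ = 1` (12/12), `λ⁻ = 2 + Σ_{m ∈ V} 2^{m-2}` (11/12;
  131a1: `60 = 44 + 16` irregular), `V` = the set of ODD levels `m ≥ 3` at which `θ_m` VANISHES IDENTICALLY (`V = ∅` ×4: 467a1, 827a1,
  1019a1, 3251a1; `{3}` ×5: 163a1, 443a1, 811a1, 3547a1, 5563a1; `{3,5}` ×2: 1811a1, 4051a1; `{3,5,7}`: 131a1); `(1,1,2,2)` ×5,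
  `(2,0,1,1)` ×3, `(0,2,1,1)`, `(1,1,0,2)`, `(2,2,1,1)` ×1: census36 §B.
* (Θ-MT) THE RANK-ONE LEADING TERM — `EdgeLeadingTermRankOneEven` / `EdgeLeadingTermRankOneOdd`.  For `r = r₋₁ = 1` the
  augmentation `t_L = 0`, so `θ_L ∈ I_{G_L}` and its image in `I/I² ≅ G_L ≅ ℤ/2^{L-1}` is the MOMENT `m_L := Σ_{j<h} j·Φ(gʲJ_L) mod 2^{L-1}`
  (`edgeThetaMoment`; base-point and orientation independent) — the Mazur–Tate / Bertolini–Darmon «regulator term» of `θ_L`.  LAW: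
  EVEN `L` (`(1,1,0,0)`, 12 curves): `v₂(m_L) = L/2 - 1` EXACTLY, 49/49 level rows (`L = 2, 4, …, 10`) — equivalently
  `L⁺_edge = T·(unit of ℤ₂⟦T⟧)`: after the `L/2 - 1` trivial zeros NOTHING divides the signed leading term; at `L = 2` it says the
  genus Gross value `x₀ = Φ(J₂)` is ODD (`x₀² = L^alg(W^{(2)})·L^alg(W^{(-2)})`, (Θ-genus) 20/20), and (Θ±-compat) PROPAGATES the parity up
  the even branch — so the even law is «rank-0 `BSD₂`-parity of the twists by `±2`» + (Θ±-compat).  ODD `L` (`r = r₋₁ = 1`, 18 curves):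
  `v₂(m_L) ≥ min((L+1)/2 + #V_{<L}, L-1)`: 36/36 + 17/17 non-zero rows, with EQUALITY on 23/24 + … decidable rows of `(1,1,0,0)` — the
  `(L-1)/2` trivial zeros, the forced SIGN ZERO at the genus point (`EdgeMinusSignZero` of V14: order `≥ 2` at `g = -1` on odd levels for
  odd rank), and one for each accidental whole-level zero `m ∈ V` (interpolated by `L⁻` ONLY: the even branch does not see `V`,
  49/49); the exception 131a1 (`v₂(m_{11}) ≥ 10 > 9`) carries 16 irregular (non-character) zeros on its odd branch.
* (Θ-genus-2) Gross's formula with its 2-part, from the archive (an4.py, all 127 curves; `L^alg = L(·,1)/Ω` as in Cremona's `allbsd`):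
  `(Φ(I)/2)² = κ·L^alg(W)L^alg(W^{(-1)})` with `κ = 1` (36/41 rank-`(0,0)` curves), `κ = #W(ℚ)_tors ∈ {3,5}` (19a1, 11a1), `κ = 2` (443c1,
  4283a1, 5303a1: `a₂ = 1`, `c(W^{(-1)}) = 2`); `(x₀ - x₁)² = 4·L^alg(W^{(2)})L^alg(W^{(-2)})` for `a₂ ∈ {0, ±2}` (20/20), ratio `1` or `2`
  for `a₂` odd (7 + 1).  Reported, not typed (normalisation of `L^alg` is not a tree primitive here).
* `a₂ = ±2` (38 curves): single-zero deflation (`Z_L = {m : L - m ≡ 3 (4)}`) is exact but `λ` of the quotient GROWS (`0,1,4,17,68,275` on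
  the odd branch): the bounded objects need Sprung's `♯/♭` matrix factorisation (`Literature: Sprung2017`), ask T65 — nothing typed.
NOTHING HERE IS A THEOREM BEYOND PRINT.  (Θ-3term), (Θ±-div), (Θ±-compat) are theorem-SHAPE (Brandt-module algebra; the last two are the
`p = 2`, `p | disc k` analogue of Pollack 2003 Thm 5.1 / Darmon–Iovita 2008 §2, where `p ∤ 2N·disc k`); (Θ-MT) is a CANDIDATE with the
census as BC5 witness.  SOURCES: Pollack 2003 [doi:10.1215/S0012-7094-03-11835-9]; Kobayashi 2003 [doi:10.1007/s00222-002-0265-4];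
Darmon–Iovita 2008 [doi:10.1017/S1474748007000126]; Bertolini–Darmon 1996 [doi:10.1007/s002220050105] §2.7–2.11 (leading terms, `p ∤ disc`);
Mazur–Tate 1987 [doi:10.1215/S0012-7094-87-05431-7] (refined conjectures, `θ ∈ I^r`, regulator term); Bertolini–Darmon 1994/1995 (derived
heights, Mazur–Tate regulators); Kurihara 2002 [doi:10.1007/s002220100206] and Pollack 2005 (Mazur–Tate elements at supersingular primes,
cyclotomic); Burungale–Büyükboduk–Lei 2024 [arXiv:2211.03722] (anticyclotomic signed theory, `p` odd unramified); Sprung 2012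
[doi:10.1016/j.jnt.2011.11.003]; Gross 1987 §11; census31–36. -/

namespace Summit.BirchSwinnertonDyer.BirchSwinnertonDyer.Cruxes.RankOneAtTwoBigImageOddLocal.SignedEdge

open Literature.NumberTheory.Automorphic Literature.NumberTheory.Automorphic.Brandt
open Literature.NumberTheory.EllipticCurves
open scoped NumberField nonZeroDivisors Pointwise Polynomial

variable {D : Type} [Ring D] [Algebra ℚ D] {k : Type} [Field k] [NumberField k]

/-- COPY of `DefiniteMod2Waldspurger.V12.IsEdgeCMIdeal` (AN43): level-`n` edge CM sub-ideal of the based Gross point `(ψ, I)` at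
the ramified prime (`J ⊆ I` invertible right `O`-ideal of index `4ⁿ`, primitive, on the `I`-side of the edge `{I, ψ(𝔭)I}`). -/
def IsEdgeCMIdeal (O : Submodule ℤ D) (ψ : k →ₐ[ℚ] D) (I : Submodule ℤ D) (𝔭 : Ideal (𝓞 k)) (n : ℕ)
    (J : Submodule ℤ D) : Prop :=
  J ∈ Brandt.rightIdeals O ∧ J ≤ I ∧ J.toAddSubgroup.relIndex I.toAddSubgroup = 4 ^ n ∧
    ¬ J ≤ Brandt.grossTranslate ψ (Ideal.span {(2 : 𝓞 k)}) I ∧ ¬ J ≤ Brandt.grossTranslate ψ 𝔭 I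

/-- COPY of `V12.edgeValue` (AN43): `Φ(J) = w_{[J]}·φ([J])`. -/
noncomputable def edgeValue (O : Submodule ℤ D) (φ : Brandt.ClassSet O → ℤ) (J : Submodule ℤ D) : ℤ :=
  (Brandt.unitIndex (Brandt.leftOrder J) : ℤ) * Brandt.evalAtLattice φ J

/-- COPY of `V12.picStep` (AN43): the CM translate by the class `g` of the norm-`5` prime `(1 + 2i₀)`, a generator of
`Pic ℤ[2ⁿ i] ≅ ℤ/2ⁿ⁻¹`. -/
def picStep (ψ : k →ₐ[ℚ] D) (i₀ : k) (n : ℕ) (J : Submodule ℤ D) : Submodule ℤ D :=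
  AddSubgroup.toIntSubmodule
    (J.toAddSubgroup ⊓ ((J.toAddSubgroup.map (AddMonoidHom.mulLeft (5 : D))).comap
      (AddMonoidHom.mulLeft (ψ ((2 : k) ^ n * (1 - 2 * i₀))))))

/-- COPY of `V12.edgeThetaCoeff` (AN43): `c_j = Φ(gʲ J₀)`, the `j`-th coefficient of `θ_n(J₀) = Σ_{j<2ⁿ⁻¹} c_j [gʲ]`. -/
noncomputable def edgeThetaCoeff (O : Submodule ℤ D) (φ : Brandt.ClassSet O → ℤ) (ψ : k →ₐ[ℚ] D) (i₀ : k)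
    (n : ℕ) (J₀ : Submodule ℤ D) (j : ℕ) : ℤ :=
  edgeValue O φ ((picStep ψ i₀ n)^[j] J₀)

/-- COPY of AN-45 `edgeThetaPoly`: `θ_n` as an integer polynomial `P_n = Σ_{j<2ⁿ⁻¹} c_j Xʲ` (`X ↔ g`; `ℤ[G_n] = ℤ[X]/(X^{2ⁿ⁻¹} - 1)`). -/
noncomputable def edgeThetaPoly (O : Submodule ℤ D) (φ : Brandt.ClassSet O → ℤ) (ψ : k →ₐ[ℚ] D) (i₀ : k)
    (n : ℕ) (J₀ : Submodule ℤ D) : ℤ[X] :=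
  ∑ j ∈ Finset.range (2 ^ (n - 1)), Polynomial.C (edgeThetaCoeff O φ ψ i₀ n J₀ j) * Polynomial.X ^ j

/-- COPY of AN-45 `edgeCharFactor`: the level-`m` CHARACTER FACTOR of `X^{2ⁿ⁻¹} - 1 = ∏_{m ≤ n} F_m`: `F_1 = X - 1`,
`F_m = Φ_{2^{m-1}}(X) = X^{2^{m-2}} + 1` for `m ≥ 2` (`m = 2`: the genus character `g ↦ -1`). -/
noncomputable def edgeCharFactor (m : ℕ) : ℤ[X] :=
  if m ≤ 1 then Polynomial.X - 1 else Polynomial.X ^ (2 ^ (m - 2)) + 1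

/-- NEW (§35): the MOMENT `m_n(J₀) := Σ_{j<2ⁿ⁻¹} j·Φ(gʲ J₀)` of `θ_n`.  When the augmentation `t_n = Σ_j Φ(gʲJ₀)` vanishes, `θ_n`
lies in the augmentation ideal `I ⊂ ℤ[G_n]` and `m_n mod 2ⁿ⁻¹` is its image under `I/I² ≅ G_n ≅ ℤ/2ⁿ⁻¹`, `[g] - 1 ↦ 1` (independent of
the base point `J₀`; `g ↦ g⁻¹` changes the sign): the Mazur–Tate regulator term / the derivative of `θ_n` at `𝟙`. -/
noncomputable def edgeThetaMoment (O : Submodule ℤ D) (φ : Brandt.ClassSet O → ℤ) (ψ : k →ₐ[ℚ] D) (i₀ : k)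
    (n : ℕ) (J₀ : Submodule ℤ D) : ℤ :=
  ∑ j ∈ Finset.range (2 ^ (n - 1)), (j : ℤ) * edgeThetaCoeff O φ ψ i₀ n J₀ j

/-- NEW (§35): the SIGNED TRIVIAL-ZERO FACTOR at level `L` for `a₂ = 0`: `ω̃_L = ∏_{2 ≤ m < L, m ≢ L (mod 2)} F_m` — the product of the
character factors of the opposite parity (Pollack's half-product `ω^∓` with `Φ_{2^{m-1}}` for `Φ_{pᵐ}`; `deg ω̃_L = q_L` of §31). -/
noncomputable def signedTrivialFactor (L : ℕ) : ℤ[X] :=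
  ∏ m ∈ (Finset.Ico 2 L).filter (fun m => m % 2 ≠ L % 2), edgeCharFactor m

/-- NEW (§35): the SIGNED MODULUS `M_L = (X - 1)·∏_{2 ≤ m ≤ L, m ≡ L (mod 2)} F_m` (so `ω̃_L · M_L = X^{2^{L-1}} - 1`): the signed quotient
`Q_L = θ_L/ω̃_L` is well defined exactly modulo `M_L`, and `ℤ[X]/(M_L) ↪ ℤ₂⟦X - 1⟧/(M_L)` with `M_L ∣ M_{L+2}`. -/
noncomputable def signedModulus (L : ℕ) : ℤ[X] :=
  (Polynomial.X - 1) * ∏ m ∈ (Finset.Icc 2 L).filter (fun m => m % 2 = L % 2), edgeCharFactor m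

/-- NEW (§35): `Q` is a SIGNED QUOTIENT of `P` at level `L`: `deg Q < 2^{L-1}` and `P = ω̃_L·Q + (X^{2^{L-1}} - 1)·R` for some `R`, i.e.
`θ_L = ω̃_L · Q` in `ℤ[G_L]`. -/
def IsSignedQuotient (P Q : ℤ[X]) (L : ℕ) : Prop :=
  Q.natDegree < 2 ^ (L - 1) ∧ ∃ R : ℤ[X], P = signedTrivialFactor L * Q + (Polynomial.X ^ (2 ^ (L - 1)) - 1) * R

/-- **(Θ-3term) `EdgeThreeTermRelation` — the group-ring three-term relation of the edge tower (support; theorem-shape, -an g32 §35).**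
`W` of prime conductor `N ≡ 3 (mod 4)`, ANY reduction type at `2`; `J` a NESTED chain of edge CM ideals (`J (m+1) ≤ J m`, level `m`).  Then for
every `n ≥ 2`, in `ℤ[X]`: `X^{2ⁿ⁻¹} - 1 ∣ P_{n+1} - a₂·P_n + F_n·P_{n-1}` — i.e. `π_{n+1→n}(θ_{n+1}) = a₂θ_n - ν(θ_{n-1})` in `ℤ[G_n]`
(`π`: `X^j ↦ X^{j mod 2ⁿ⁻¹}`; `ν` = corestriction = multiplication by `F_n = X^{2^{n-2}} + 1`).  MECHANISM: Brandt `B(2)`-adjacency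
`a₂Φ(v) = Σ_{v'∼v}Φ(v')` summed over the `G_n`-orbit of `J_n`: the two conductor-`2^{n+1}` neighbours of `gʲJ_n` are the two lifts of its
class, the conductor-`2^{n-1}` neighbour is its image.  DATA = BC5 WITNESS: 892/892 level triples `(n-1, n, n+1)`, `2 ≤ n ≤ 10`, on all 127
curves (`a₂ ∈ {0, ±1, ±2}`), verbatim on the T58 archive (pm35.py A).  WHY IT MIGHT FAIL: only through the typed set-up (`picStep` at level
`n+1` must induce the class of `picStep` at level `n` under `Pic ℤ[2^{n+1}i] → Pic ℤ[2ⁿi]`; T58-verified `n ≤ 11`).  SOURCES: Gross 1987 §§3, 11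
[Gross1987Heights]; Bertolini–Darmon 1996 §2.4–2.6 (norm-compatibility of Gross points, `p ∤ disc K`) [doi:10.1007/s002220050105];
Darmon–Iovita 2008 Prop. 2.? («`a_p θ_n = π θ_{n+1} + ν θ_{n-1}`», `a_p = 0`) [doi:10.1017/S1474748007000126]; census36 §A. -/
def EdgeThreeTermRelation : Prop :=
  ∀ (W : WeierstrassCurve ℚ) [W.IsElliptic] [W.IsGloballyMinimal] (N : ℕ),
    N.Prime → N % 4 = 3 → W.conductorNorm ℤ = N →
  ∀ (k : Type) [Field k] [NumberField k], IsImaginaryQuadratic k → NumberField.discr k = -4 →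
  ∀ (i₀ : k), i₀ ^ 2 = -1 → ∀ (𝔭 : Ideal (𝓞 k)), 𝔭 ^ 2 = Ideal.span {(2 : 𝓞 k)} →
  ∀ (S : Brandt.XiSetup 1 N) [Fintype (Brandt.ClassSet S.O)] (φ : Brandt.ClassSet S.O → ℤ) (ψ : k →ₐ[ℚ] S.D)
    (I : Submodule ℤ S.D), Brandt.IsGrossPoint S.O ψ I →
    φ ≠ 0 → Brandt.eigenLattice N (Brandt.matrix S.O) (fun p => W.frobeniusTrace p) = ℤ ∙ φ →
  ∀ (J : ℕ → Submodule ℤ S.D), (∀ m ≥ 1, IsEdgeCMIdeal S.O ψ I 𝔭 m (J m)) → (∀ m ≥ 1, J (m + 1) ≤ J m) →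
  ∀ n ≥ 2,
    (Polynomial.X ^ (2 ^ (n - 1)) - 1 : ℤ[X]) ∣
      (edgeThetaPoly S.O φ ψ i₀ (n + 1) (J (n + 1)) - Polynomial.C (W.frobeniusTrace 2) * edgeThetaPoly S.O φ ψ i₀ n (J n)
        + edgeCharFactor n * edgeThetaPoly S.O φ ψ i₀ (n - 1) (J (n - 1)))

/-- **(Θ±-div) `SignedEdgeDivisibility` — the trivial zeros of the supersingular edge tower are EXACTLY DIVISIBLE OUT (support;
theorem-shape, -an g32 §35; §31 (F3) numerically).**  `a₂ = 0`: for every `L ≥ 3` and every level-`L` edge CM ideal, `θ_L = ω̃_L·Q_L` in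
`ℤ[G_L]` for some `Q_L` of degree `< 2^{L-1}`, `ω̃_L = ∏_{2 ≤ m < L, m ≢ L (2)} F_m` (values at the characters of the opposite-parity levels are
the trivial zeros `c_{L-m}(0) = 0`, and `ℤ[G_L]`-divisibility, not only vanishing of values, holds).  DATA = BC5 WITNESS: 254/254 level rows
`L ≥ 3` on the 36 `a₂ = 0` curves, exact polynomial division (pm35.py C).  WHY IT MIGHT FAIL: divisibility in `ℤ[G_L]` is stronger than
vanishing at the characters only by torsion-freeness of `ℤ[X]/(F_m)` — it cannot fail given the character zeros, which follow from (Θ-3term);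
listed as support.  SOURCES: Pollack 2003 §4 (`ω_n^±`, `p` odd) [doi:10.1215/S0012-7094-03-11835-9]; T58 (F3); census36 §A. -/
def SignedEdgeDivisibility : Prop :=
  ∀ (W : WeierstrassCurve ℚ) [W.IsElliptic] [W.IsGloballyMinimal] (N : ℕ),
    N.Prime → N % 4 = 3 → W.conductorNorm ℤ = N → W.frobeniusTrace 2 = 0 →
  ∀ (k : Type) [Field k] [NumberField k], IsImaginaryQuadratic k → NumberField.discr k = -4 →
  ∀ (i₀ : k), i₀ ^ 2 = -1 → ∀ (𝔭 : Ideal (𝓞 k)), 𝔭 ^ 2 = Ideal.span {(2 : 𝓞 k)} →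
  ∀ (S : Brandt.XiSetup 1 N) [Fintype (Brandt.ClassSet S.O)] (φ : Brandt.ClassSet S.O → ℤ) (ψ : k →ₐ[ℚ] S.D)
    (I : Submodule ℤ S.D), Brandt.IsGrossPoint S.O ψ I →
    φ ≠ 0 → Brandt.eigenLattice N (Brandt.matrix S.O) (fun p => W.frobeniusTrace p) = ℤ ∙ φ →
  ∀ L ≥ 3, ∀ (J₀ : Submodule ℤ S.D), IsEdgeCMIdeal S.O ψ I 𝔭 L J₀ →
    ∃ Q : ℤ[X], IsSignedQuotient (edgeThetaPoly S.O φ ψ i₀ L J₀) Q L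

/-- **(Θ±-compat) `SignedEdgeCompatibility` — the signed quotients two levels apart agree up to sign modulo `M_L`; the signed 2-adic
`L`-functions `L^±_edge ∈ ℤ₂⟦T⟧` exist (support; theorem-shape corollary of (Θ-3term), -an g32 §35; beyond print as an OBJECT at `p = 2 | disc k`).**
`a₂ = 0`, `J` a nested chain of edge CM ideals: for every `L ≥ 2` and all signed quotients `Q_L` of `θ_L`, `Q_{L+2}` of `θ_{L+2}`:
`M_L ∣ Q_{L+2} + Q_L` in `ℤ[X]`, `M_L = (X-1)·∏_{2 ≤ m ≤ L, m ≡ L (2)} F_m` (`π_{L+2→L}` is reduction mod `X^{2^{L-1}} - 1 ∈ (M_L)`).  Hence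
`((-1)^{⌊L/2⌋} Q_L)_{L ≡ ε (2)}` is a COMPATIBLE SYSTEM in `lim ℤ[X]/(M_L) = ℤ₂⟦X-1⟧`: `L^ε_edge(W)`.  DATA = BC5 WITNESS: 218/218 level pairs
(36 curves; an6.py: `Q_{L+2} + Q_L` divisible by `X-1`, by every `F_m`, `m ≡ L (2)`, and by their product).  The naive guess «`π Q_{L+2} = ±Q_L`
in `ℤ[G_L]`» is FALSE (148 level pairs need the modulus).  WHY IT MIGHT FAIL: only with (Θ-3term) (the cancellation of `ω̃_L`, coprime to
`M_L` in `ℤ[X]`, is exact algebra).  SOURCES: Pollack 2003 Thm 5.1 / Lemma 4.? (cyclotomic, `p` odd, `a_p = 0`); Darmon–Iovita 2008 §2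
(anticyclotomic definite, `p ∤ disc k`) [doi:10.1017/S1474748007000126]; Burungale–Büyükboduk–Lei [arXiv:2211.03722] §4; census36 §A. -/
def SignedEdgeCompatibility : Prop :=
  ∀ (W : WeierstrassCurve ℚ) [W.IsElliptic] [W.IsGloballyMinimal] (N : ℕ),
    N.Prime → N % 4 = 3 → W.conductorNorm ℤ = N → W.frobeniusTrace 2 = 0 →
  ∀ (k : Type) [Field k] [NumberField k], IsImaginaryQuadratic k → NumberField.discr k = -4 →
  ∀ (i₀ : k), i₀ ^ 2 = -1 → ∀ (𝔭 : Ideal (𝓞 k)), 𝔭 ^ 2 = Ideal.span {(2 : 𝓞 k)} →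
  ∀ (S : Brandt.XiSetup 1 N) [Fintype (Brandt.ClassSet S.O)] (φ : Brandt.ClassSet S.O → ℤ) (ψ : k →ₐ[ℚ] S.D)
    (I : Submodule ℤ S.D), Brandt.IsGrossPoint S.O ψ I →
    φ ≠ 0 → Brandt.eigenLattice N (Brandt.matrix S.O) (fun p => W.frobeniusTrace p) = ℤ ∙ φ →
  ∀ (J : ℕ → Submodule ℤ S.D), (∀ m ≥ 1, IsEdgeCMIdeal S.O ψ I 𝔭 m (J m)) → (∀ m ≥ 1, J (m + 1) ≤ J m) →
  ∀ L ≥ 2, ∀ (Q Q' : ℤ[X]),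
    IsSignedQuotient (edgeThetaPoly S.O φ ψ i₀ L (J L)) Q L →
    IsSignedQuotient (edgeThetaPoly S.O φ ψ i₀ (L + 2) (J (L + 2))) Q' (L + 2) →
      signedModulus L ∣ Q' + Q

/-- **(Θ-MT⁺) `EdgeLeadingTermRankOneEven` — the signed leading term on the EVEN branch is a UNIT for the rank-`(1,1,0,0)` supersingular
curves (candidate, -an g32 §35; beyond print; the crux's own population).**  `W` of prime conductor `N ≡ 3 (mod 4)` with `a₂ = 0`,
`r_an(W) = r_an(W^{(-1)}) = 1`, `r_an(W^{(2)}) = r_an(W^{(-2)}) = 0`.  Then at every EVEN level `L ≥ 2` and every level-`L` edge CM ideal: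
`t_L = 0` (`θ_L ∈ I`) and the moment `m_L = Σ_{j<2^{L-1}} j·Φ(gʲJ_L)` — the image of `θ_L` in `I/I² = ℤ/2^{L-1}` — has
`v₂(m_L) = L/2 - 1` EXACTLY: the `L/2 - 1` trivial zeros (odd levels `3, 5, …, L-1`, each `F_m(1) = 2`) and NOTHING ELSE; equivalently
`Q_L(1) = 0` and `Q_L'(1)` is ODD, i.e. `L⁺_edge(W) = T·u(T)`, `u ∈ ℤ₂⟦T⟧ˣ` (`λ⁺ = 1`, `μ⁺ = 0`, signed leading coefficient a `2`-adic unit).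
READING (Mazur–Tate / Bertolini–Darmon dictionary, conjectural at `p = 2 | disc k`): order of vanishing `1 = rank W(k) - 1` … no: `= max(r, r₋₁)`
((Θ-ρ) of AN-45), and unit leading term `⟺` the `2`-part of `#Ш(W/k)·∏c_v·(signed 2-adic height of the Heegner point)/#tors²` is trivial —
the analytic incarnation of `BSD₂(W) ∧ BSD₂(W^{(-1)})` for this class (all 12 archive curves have `Ш_an = ∏c = #tors = 1` for `W` and `W^{(-1)}`:
consistency, not yet a test; ask D-an-35b = curves of this type with non-trivial 2-parts).  STRUCTURE: at `L = 2` the law says the genus value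
`x₀ = Φ(J₂)` is odd (`x₀² = L^alg(W^{(2)})L^alg(W^{(-2)})`), and (Θ±-compat) propagates `Q_L'(1) mod 2` up the branch — so (Θ-MT⁺) ⟸
(Θ±-compat) + «`L^alg(W^{(±2)})` odd».  DATA = BC5 WITNESS: 12/12 curves (131a1, 163a1, 443a1, 467a1, 811a1, 827a1, 1019a1, 1811a1, 3251a1,
3547a1, 4051a1, 5563a1), 49/49 even level rows (an11.py LAW5; an7.py: `Q_L'(1)` odd 49/49).  WHY IT MIGHT FAIL: a curve of this rank pattern
with `L^alg(W^{(2)})L^alg(W^{(-2)})` EVEN (e.g. `Ш(W^{(±2)})[2] ≠ 0` or even Tamagawa number at the additive prime `2`; none with `N ≤ 5563`)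
breaks it at `L = 2` — the honest form is then `v₂(m_L) = L/2 - 1 + v₂(x₀)`.  **VERDICT (REF1-AUDIT §343 + §343-add1, 2026-08-30):
KILLED modulo (Θ-genus-2), class refuted-misstated** — 7 of 232 rank-1 optimal classes `N < 5·10⁵`, `a₂ = 0`, pattern `(1,1,0,0)` have even mass
`(Ш_an(W₂), Ш_an(W₋₂)) = (4,4)`: 54163a, 184211a, 228731a, 254987a, 324211a, 327739a, 433651a (kit j339512/j339524; pending the genus datum
D-an-35b′); repairs: C′ = this statement + hypothesis «`x₀` odd» (unit class, a corollary of (Θ±-compat)), C″ = `v₂(m_L) = L/2 - 1 + v₂(x₀)`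
EXACTLY (typed in ♯-coordinates as AN-48 `SharpLeadingTermRankOneMass`); the decl is kept verbatim as the settled edge.  SOURCES: Mazur–Tate 1987 [doi:10.1215/S0012-7094-87-05431-7]
Conj. 3–4; Bertolini–Darmon 1996 Conj. 2.13/Thm 2.? [doi:10.1007/s002220050105]; Kurihara 2002 [doi:10.1007/s002220100206] §0 (cyclotomic
`a_p = 0` analogue); Darmon–Iovita 2008; census36 §B–§C. -/
def EdgeLeadingTermRankOneEven : Prop :=
  ∀ (W : WeierstrassCurve ℚ) [W.IsElliptic] [W.IsGloballyMinimal] (N : ℕ),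
    N.Prime → N % 4 = 3 → W.conductorNorm ℤ = N → W.frobeniusTrace 2 = 0 → W.analyticRank = 1 →
  ∀ (W₁ : WeierstrassCurve ℚ) [W₁.IsElliptic] [W₁.IsGloballyMinimal] (C₁ : WeierstrassCurve.VariableChange ℚ),
    C₁ • W₁ = W.quadraticTwist (-1 : ℚ) → W₁.analyticRank = 1 →
  ∀ (W₂ : WeierstrassCurve ℚ) [W₂.IsElliptic] [W₂.IsGloballyMinimal] (C₂ : WeierstrassCurve.VariableChange ℚ),
    C₂ • W₂ = W.quadraticTwist (2 : ℚ) → W₂.analyticRank = 0 →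
  ∀ (W₃ : WeierstrassCurve ℚ) [W₃.IsElliptic] [W₃.IsGloballyMinimal] (C₃ : WeierstrassCurve.VariableChange ℚ),
    C₃ • W₃ = W.quadraticTwist (-2 : ℚ) → W₃.analyticRank = 0 →
  ∀ (k : Type) [Field k] [NumberField k], IsImaginaryQuadratic k → NumberField.discr k = -4 →
  ∀ (i₀ : k), i₀ ^ 2 = -1 → ∀ (𝔭 : Ideal (𝓞 k)), 𝔭 ^ 2 = Ideal.span {(2 : 𝓞 k)} →
  ∀ (S : Brandt.XiSetup 1 N) [Fintype (Brandt.ClassSet S.O)] (φ : Brandt.ClassSet S.O → ℤ) (ψ : k →ₐ[ℚ] S.D)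
    (I : Submodule ℤ S.D), Brandt.IsGrossPoint S.O ψ I →
    φ ≠ 0 → Brandt.eigenLattice N (Brandt.matrix S.O) (fun p => W.frobeniusTrace p) = ℤ ∙ φ →
  ∀ L ≥ 2, L % 2 = 0 → ∀ (J₀ : Submodule ℤ S.D), IsEdgeCMIdeal S.O ψ I 𝔭 L J₀ →
    (∑ j ∈ Finset.range (2 ^ (L - 1)), edgeThetaCoeff S.O φ ψ i₀ L J₀ j) = 0 ∧
    (2 : ℤ) ^ (L / 2 - 1) ∣ edgeThetaMoment S.O φ ψ i₀ L J₀ ∧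
    ¬ (2 : ℤ) ^ (L / 2) ∣ edgeThetaMoment S.O φ ψ i₀ L J₀

/-- **(Θ-MT⁻) `EdgeLeadingTermRankOneOdd` — the ODD-branch leading term carries the sign zero and the accidental level zeros
(candidate, -an g32 §35; beyond print).**  `W` of prime conductor `N ≡ 3 (mod 4)`, `a₂ = 0`, `r_an(W) = r_an(W^{(-1)}) = 1` (no hypothesis
on `W^{(±2)}`), `J` a nested chain of edge CM ideals.  For every ODD level `L ≥ 3`: `t_L = 0` and
`2^{min((L+1)/2 + #V_{<L}, L-1)} ∣ m_L`, where `V_{<L} = {3 ≤ m < L odd : θ_m = 0}` is the set of lower odd levels at which the theta element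
VANISHES IDENTICALLY (all `2^{m-2}` primitive conductor-`2^m` twisted central values `L(W/k, χ, 1) = 0` although their sign is `+1`).
The count: `(L-1)/2` trivial zeros (even levels `m < L`) + `1` for the SIGN ZERO at the genus point (`EdgeMinusSignZero`, V14: on odd levels
of an odd-rank curve `θ_L` vanishes to order `≥ 2` at `g = -1`) + `1` for each `m ∈ V_{<L}` (a simple zero of `L⁻_edge` at the level-`m`
characters; the even branch does NOT acquire these zeros: (Θ-MT⁺) is exact regardless of `V`).  EQUALITY («no irregular zeros») holds on
23/24 decidable rows of the 12 `(1,1,0,0)` curves and fails only for 131a1 at `L = 11` (`v₂(m_{11}) ≥ 10 > 9`: 16 irregular zeros, `λ⁻ = 60 =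
2 + 2 + 8 + 32 + 16`); so `λ(L⁻_edge) = 2 + Σ_{m∈V} 2^{m-2} (+ λ_irr)` and `v₂(L⁻_edge'(0)) = 1 + #V (+ M_irr)`.  DATA = BC5 WITNESS
(inequality as typed): 18/18 curves with `r = r₋₁ = 1` (`(1,1,0,0)` ×12, `(1,1,2,2)` ×5, `(1,1,0,2)` ×1), 0 violations on all odd level rows
`3 ≤ L ≤ 11` (an11.py LAW6 + table).  `V` census (`(1,1,0,0)`): `∅` ×4, `{3}` ×5, `{3,5}` ×2, `{3,5,7}` ×1 — whole-level vanishing at odd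
`m ≥ 3` occurs ONLY for `a₂ = 0` (never for `a₂ = ±2` or `a₂` odd in rank `(1,1,0,0)`, 0/14).  WHY IT MIGHT FAIL: the typed inequality only
if a whole-level zero `m ∈ V` were NOT interpolated as a zero of the odd branch at higher levels (it is forced by (Θ±-compat): `Q_{L} ≡ ∓Q_m·(…)`
modulo `F_m`) — so the risk sits in (Θ-3term); the EQUALITY form is false (131a1).  SOURCES: as (Θ-MT⁺); `EdgeMinusSignZero` (V14, (Θ-FEⁿ)
832/832); Cornut–Vatsal 2007 (finiteness of character zeros, `p ∤ N disc`); census36 §B. -/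
def EdgeLeadingTermRankOneOdd : Prop :=
  ∀ (W : WeierstrassCurve ℚ) [W.IsElliptic] [W.IsGloballyMinimal] (N : ℕ),
    N.Prime → N % 4 = 3 → W.conductorNorm ℤ = N → W.frobeniusTrace 2 = 0 → W.analyticRank = 1 →
  ∀ (W₁ : WeierstrassCurve ℚ) [W₁.IsElliptic] [W₁.IsGloballyMinimal] (C₁ : WeierstrassCurve.VariableChange ℚ),
    C₁ • W₁ = W.quadraticTwist (-1 : ℚ) → W₁.analyticRank = 1 →
  ∀ (k : Type) [Field k] [NumberField k], IsImaginaryQuadratic k → NumberField.discr k = -4 →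
  ∀ (i₀ : k), i₀ ^ 2 = -1 → ∀ (𝔭 : Ideal (𝓞 k)), 𝔭 ^ 2 = Ideal.span {(2 : 𝓞 k)} →
  ∀ (S : Brandt.XiSetup 1 N) [Fintype (Brandt.ClassSet S.O)] (φ : Brandt.ClassSet S.O → ℤ) (ψ : k →ₐ[ℚ] S.D)
    (I : Submodule ℤ S.D), Brandt.IsGrossPoint S.O ψ I →
    φ ≠ 0 → Brandt.eigenLattice N (Brandt.matrix S.O) (fun p => W.frobeniusTrace p) = ℤ ∙ φ →
  ∀ (J : ℕ → Submodule ℤ S.D), (∀ m ≥ 1, IsEdgeCMIdeal S.O ψ I 𝔭 m (J m)) → (∀ m ≥ 1, J (m + 1) ≤ J m) →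
  ∀ L ≥ 3, L % 2 = 1 →
    (∑ j ∈ Finset.range (2 ^ (L - 1)), edgeThetaCoeff S.O φ ψ i₀ L (J L) j) = 0 ∧
    (2 : ℤ) ^ (min ((L + 1) / 2 + Set.ncard {m : ℕ | 3 ≤ m ∧ m < L ∧ m % 2 = 1 ∧ edgeThetaPoly S.O φ ψ i₀ m (J m) = 0}) (L - 1))
      ∣ edgeThetaMoment S.O φ ψ i₀ L (J L)

/-- Sanity: the character factors at `m = 1, 2, 3`. -/
theorem edgeCharFactor_one : edgeCharFactor 1 = Polynomial.X - 1 := by simp [edgeCharFactor]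
theorem edgeCharFactor_two : edgeCharFactor 2 = Polynomial.X + 1 := by simp [edgeCharFactor]
theorem edgeCharFactor_three : edgeCharFactor 3 = Polynomial.X ^ 2 + 1 := by simp [edgeCharFactor]

/-- Sanity: `0` is a signed quotient of `0` at every level `L ≥ 1`. -/
theorem isSignedQuotient_zero (L : ℕ) : IsSignedQuotient 0 0 L :=
  ⟨by simp, ⟨0, by simp⟩⟩

end Summit.BirchSwinnertonDyer.BirchSwinnertonDyer.Cruxes.RankOneAtTwoBigImageOddLocal.SignedEdge
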